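import Literature.ModelTheory.Quasiminimal.ContinuumQuasiminimal
import Literature.ModelTheory.Quasiminimal.ContinuumStrong
import Literature.ModelTheory.Quasiminimal.ContinuumAxiomFour
import HarnessLib

/-!
# The continuum model over a base: assembly

For a `Setup L M cl` (a countable quasiminimal exponential field chart) which is algebraically
closed of characteristic zero and carries a base `ιM : K → M` fixed by all partial embeddings,
with surjective exponential, standard kernel `ℤ · ιM τ`, exponential extending `θ` on `D`,
strong base, Bays–Kirby's axiom 4 over the base, and `ecl ⊆ cl`, the continuum model `F = S.F`
is an exponential field of cardinality exactly `𝔠` which is quasiminimal, algebraically closed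
with surjective exponential, extends `(K, D, θ)` with kernel `ℤ · ιF τ`, has strong base,
satisfies axiom 4 over the base and the countable closure property — i.e. all conjuncts of
`Literature.NumberTheory.Transcendental.baysKirby2018_modelOverPartialExpField` for this base
(Bays–Kirby 2018, Thm 1.3 / Thm 8.2 / Cor. 9.4, the step "models of cardinality `2^ℵ₀`" from the
countable model). What remains for that named fact is the construction of such a `Setup` over
every standard-kernel partial exponential field (B–K §§5–6: the countable saturated model and
its quasiminimal pregeometry structure).

## References

* M. Bays, J. Kirby, *Pseudo-exponential maps, variants, and quasiminimality*, Algebra & Number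
  Theory 12 (2018), Thm 1.3, Thm 8.2, Cor. 9.4.
-/

noncomputable section

suppress_compilation

open Set Cardinal
open Literature.ModelTheory.ExponentialFields Literature.ModelTheory.ExponentialFields.ExponentialRing
open Literature.NumberTheory.Transcendental

namespace Literature.ModelTheory.Quasiminimal

namespace Setup

open FirstOrder FirstOrder.Language

variable {L : Language.{0, 0}} {M : Type} [L.Structure M] [Field M] [ExponentialRing M]
  {cl : Set M → Set M} (S : Setup L M cl)

include S in
/-- **The continuum model over a base** (Bays–Kirby 2018, Thm 1.3 with Thm 8.2 and Cor. 9.4, the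
passage from the countable chart to cardinality `2^ℵ₀`): all conjuncts of
`baysKirby2018_modelOverPartialExpField` hold for `F = S.F`, `ι = S.ιF ιM`, given the
corresponding properties of the chart `M`. [cite: BaysKirby2018ANT, Thm 1.3, Thm 8.2, Cor. 9.4] -/
theorem exists_continuumModel_over_base [CharZero M] [IsAlgClosed M]
    {K : Type} [Field K] [CharZero K] (D : Submodule ℚ K) (θ : K → K) (τ : K) (ιM : K →+* M)
    (hfix : ∀ σ : M → M, IsQFEmbOn L σ Set.univ → ∀ k, σ (ιM k) = ιM k)
    (hsurj : IsSurjectiveOntoUnits M)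
    (hexp : ∀ x ∈ D, exp (ιM x) = ιM (θ x))
    (hker : expKernel M = AddSubgroup.zmultiples (ιM τ))
    (hstrong : GammaField.IsStrong (Submodule.span ℚ (ιM '' D)))
    (h4 : ∀ (n : ℕ) (W : Set (Fin n ⊕ Fin n → M)), IsIrreducibleClosed M W →
      (W ∩ torusLocus M n).Nonempty → IsRotund M n (W ∩ torusLocus M n) →
      IsAddFree M n (W ∩ torusLocus M n) → IsMulFree M n (W ∩ torusLocus M n) →
      zariskiDim M W = n →
      ∀ A : Finset M, ∃ z ∈ W ∩ expGraph M n,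
        ∀ m : Fin n → ℤ, (∑ i, (m i : M) * z (Sum.inl i)) ∈
          Submodule.span ℚ (ιM '' D ∪ ↑A) → m = 0)
    (hecl : ∀ A : Set M, ecl A ⊆ cl A) :
    ∃ (F : Type) (_ : Field F) (_ : CharZero F) (_ : ExponentialRing F) (ι : K →+* F),
      #F = 𝔠 ∧ Language.expRing.IsQuasiminimal F ∧
      IsAlgClosed F ∧ IsSurjectiveOntoUnits F ∧
      (∀ x ∈ D, exp (ι x) = ι (θ x)) ∧ expKernel F = AddSubgroup.zmultiples (ι τ) ∧
      GammaField.IsStrong (Submodule.span ℚ (ι '' D)) ∧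
      (∀ (n : ℕ) (W : Set (Fin n ⊕ Fin n → F)), IsIrreducibleClosed F W →
        (W ∩ torusLocus F n).Nonempty → IsRotund F n (W ∩ torusLocus F n) →
        IsAddFree F n (W ∩ torusLocus F n) → IsMulFree F n (W ∩ torusLocus F n) →
        zariskiDim F W = n →
        ∀ A : Finset F, ∃ z ∈ W ∩ expGraph F n,
          ∀ m : Fin n → ℤ, (∑ i, (m i : F) * z (Sum.inl i)) ∈
            Submodule.span ℚ (ι '' D ∪ ↑A) → m = 0) ∧
      (∀ X : Set F, X.Finite → (ecl X).Countable) :=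
  ⟨S.F, inferInstance, S.instCharZeroF, inferInstance, S.ιF ιM, S.mk_F, S.isQuasiminimal_F,
    S.isAlgClosed_F, S.isSurjectiveOntoUnits_F hsurj, S.exp_ιF ιM hexp,
    S.expKernel_F_eq ιM hfix hker, S.isStrong_F ιM hfix hstrong, S.axiom4_F ιM hfix (D : Set K) h4,
    S.countable_ecl hecl⟩

end Setup

end Literature.ModelTheory.Quasiminimal

end
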